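import Summits.BirchSwinnertonDyer.BirchSwinnertonDyer.Theorems.KolyvaginRankRigidityAtTwoStrongSystemOfBoundedDefect
import Summits.BirchSwinnertonDyer.BirchSwinnertonDyer.Theorems.KolyvaginRankRigidityAtTwoClassPointCurrencyAtTwo
import HarnessLib

/-!
# Cruxes V1′ₛ `KolyvaginNonvanishingAtTwoFrameStrong` (stmt-BirchSwinnertonDyer-27014) and V1′θ
# `KolyvaginNonvanishingAtTwoFrameTheta` (stmt-BirchSwinnertonDyer-27219), lines `level_one_split_margin` /
# `level_one_split_theta`: the OPEN torsion stubs `stub_torsionLevelOneMargin` / `stub_torsionLevelOneTheta`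
# placed in the route's kernel-checked chain — they follow BY NAME from U1 `KolyvaginBoundedDefectAtTwo`
# (stmt-BirchSwinnertonDyer-28083), and the margin stub is the `θ = 1` case of the theta stub; plus the
# margin stub in McCallum's POINT currency

Helper file (`--supports`), THEOREMS ONLY (no definition, no named fact, no `sorry`). Nothing here closes a
registered stub: the two torsion stubs ARE Kolyvagin's conjecture at `p = 2` (strong / relative-margin form)
on the frames whose conductor-`1` derived point `P(1) = y_K` is torsion, which is beyond print (W. Zhang 2014
Thm. 1.1 needs `p ≥ 5`). What is recorded:

* `torsionLevelOneTheta_of_strongNonzeroSystem` / `…_of_boundedDefect` — the theta torsion stub is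
  implied by V1′∞ `KolyvaginStrongNonzeroSystemAtTwo` (27983; forget the depth) and hence by U1
  `KolyvaginBoundedDefectAtTwo` (28083) ALONE, through the landed
  `KolyvaginSwap.nonvanishingAtTwoFrameTheta_of_boundedDefect` (no print fact enters);
* `torsionLevelOneMargin_of_torsionLevelOneTheta` — V1′ₛ's torsion stub is the `θ = 1` instance of V1′θ's;
  `torsionLevelOneMargin_of_boundedDefect` — hence also implied by U1 alone;
* `torsionLevelOneMargin_iff_pointForm` — the margin torsion stub is EQUIVALENT to its point form
  «… ⇒ some derived Heegner point `P(n)` at a square-free product `n` of Kolyvagin primes at `2` is not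
  `2^M`-divisible in `E(K[n])` with `1 ≤ M`, `M + k ≤ M(n)`» (McCallum Cor. 4.5 at `2` on the habitat,
  `KolyvaginRankRigidity.kolyvaginClass_two_ne_zero_iff_not_pDiv`, pointwise; `M ≤ M + k ≤ M(n)`);
* `exists_class_of_pointCertificate_theta` — for the theta form the supplier's direction: a point
  certificate `2^M ∤ P(n)` with `1 ≤ M ≤ M(n)` and `θ M + k ≤ M(n)` IS a witness of the stub's conclusion.

So the exact remaining content of both items is ONE open statement, U1 (⟺ `DeepSeedAtTwo`): a FIXED level
`M₁ ≥ 1` and depth `r` with `c_{M₁}(n) ≠ 0` on depth-`r` Kolyvagin conductors of unbounded index.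
HONEST FRAMING: implications between open statements and a re-expression; U1, V1′∞, V1′θ, V1′ₛ stay OPEN;
no stub is closed by this file; BSD is NOT proved by any of this.

References (locators only): [cite: Kolyvagin1991MathAnn, §2 (2.1), Conj. 2.5, p. 257]
[cite: McCallumLMS1991, §4 (4)–(6), Cor. 4.5] [cite: GrossLMS1991, Prop. 3.6, Lemma 4.3, Prop. 4.7 (1)]
[cite: WZhang2014, Thm. 1.1, Notations (xii)].
-/

set_option autoImplicit false
-- the Theorems namespace of this sub repeats the summit name by design (D-0017 nested layout)
set_option linter.dupNamespace false

noncomputable section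

open scoped Classical

open WeierstrassCurve Field Literature.NumberTheory.EllipticCurves
  Literature.NumberTheory.EllipticCurves.ModularForms
open Summit.BirchSwinnertonDyer.Rank1Residual.X11b.Three
open Summit.BirchSwinnertonDyer.BirchSwinnertonDyer.Theses.KolyvaginRankRigidityAtTwo

namespace Summit.BirchSwinnertonDyer.BirchSwinnertonDyer.Theorems.KolyvaginAtTwo

/-! ## §1 The theta torsion stub (27219) from V1′∞ and from U1 -/

/-- **V1′∞ ⟹ `stub_torsionLevelOneTheta`** (the registered torsion stub of the 27219 skeleton, signature
VERBATIM as conclusion): a strong non-zero system of some depth `r` gives, for every `θ, k`, the required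
class — forget the depth and the torsion hypothesis. Both sides OPEN. [cite: Kolyvagin1991MathAnn, p. 259 (2.1)] -/
theorem torsionLevelOneTheta_of_strongNonzeroSystem (h : KolyvaginStrongNonzeroSystemAtTwo) :
    ∀ (W : WeierstrassCurve ℚ) [W.IsElliptic] [W.IsGloballyMinimal], ¬ W.HasCM → (Literature.NumberTheory.EllipticCurves.Rank1Residual.GoodOrd W 2 ∨ Literature.NumberTheory.EllipticCurves.Rank1Residual.Mult W 2) → (∀ m : ℕ, W.HasSurjectiveModNGaloisRep (2 ^ m : ℕ)) → ∀ (K : Type) [Field K] [NumberField K], Literature.NumberTheory.EllipticCurves.IsImaginaryQuadratic K → ∀ [NeZero (W.conductorNorm ℤ)], Literature.NumberTheory.EllipticCurves.SatisfiesHeegnerHypothesis (W.conductorNorm ℤ) K → Odd (NumberField.discr K) → NumberField.discr K ≠ -3 → AddSubgroup.torsionBy (W.baseChange K).toAffine.Point (2 : ℤ) = ⊥ → Literature.NumberTheory.EllipticCurves.SatisfiesHeegnerHypothesis 2 K → ∀ (Dt : Literature.NumberTheory.EllipticCurves.ModularForms.ModularParametrizationData W (W.conductorNorm ℤ)) (β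 : ℤ) (ι : K →+* ℂ), (4 * (W.conductorNorm ℤ : ℤ)) ∣ β ^ 2 - NumberField.discr K → (∀ d₁ : Literature.NumberTheory.EllipticCurves.KolyvaginHeegnerData Dt β ι 1, IsOfFinAddOrder d₁.derivedPoint) → ∀ θ k : ℕ, ∃ (n : ℕ) (d : Literature.NumberTheory.EllipticCurves.KolyvaginHeegnerData Dt β ι n) (M : ℕ), Literature.NumberTheory.EllipticCurves.KolyvaginDescent.KolSupp (Literature.NumberTheory.EllipticCurves.Zhang2014.IsKolyvaginPrime (W.conductorNorm ℤ) W K 2) n ∧ 1 ≤ M ∧ ((θ * M + k : ℕ) : ℕ∞) ≤ Literature.NumberTheory.EllipticCurves.Zhang2014.levelIndex W 2 n ∧ d.kolyvaginClass Nat.prime_two M ≠ 0 := by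
  intro W _ _ hCM hred hsur K _ _ hK _ hHN hodd hne3 htor hH2 Dt β ι hβ _ θ k
  exact nonvanishingAtTwoFrameTheta_of_strongNonzeroSystem h W hCM hred hsur K hK hHN hodd hne3 htor hH2
    Dt β ι hβ θ k

/-- **U1 ⟹ `stub_torsionLevelOneTheta`**: the registered torsion stub of 27219 follows from the route's open
child U1 `KolyvaginBoundedDefectAtTwo` (stmt-BirchSwinnertonDyer-28083) ALONE, through the landed kernel
link `KolyvaginSwap.nonvanishingAtTwoFrameTheta_of_boundedDefect` (level lowering to the deep seed, then
forget the depth; no print fact). Both sides OPEN; closes nothing. [cite: Kolyvagin1991MathAnn, §2 (2.1), Conj. 2.5]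
[cite: McCallumLMS1991, §4 (4)–(6)] -/
theorem torsionLevelOneTheta_of_boundedDefect (h : KolyvaginBoundedDefectAtTwo) :
    ∀ (W : WeierstrassCurve ℚ) [W.IsElliptic] [W.IsGloballyMinimal], ¬ W.HasCM → (Literature.NumberTheory.EllipticCurves.Rank1Residual.GoodOrd W 2 ∨ Literature.NumberTheory.EllipticCurves.Rank1Residual.Mult W 2) → (∀ m : ℕ, W.HasSurjectiveModNGaloisRep (2 ^ m : ℕ)) → ∀ (K : Type) [Field K] [NumberField K], Literature.NumberTheory.EllipticCurves.IsImaginaryQuadratic K → ∀ [NeZero (W.conductorNorm ℤ)], Literature.NumberTheory.EllipticCurves.SatisfiesHeegnerHypothesis (W.conductorNorm ℤ) K → Odd (NumberField.discr K) → NumberField.discr K ≠ -3 → AddSubgroup.torsionBy (W.baseChange K).toAffine.Point (2 : ℤ) = ⊥ → Literature.NumberTheory.EllipticCurves.SatisfiesHeegnerHypothesis 2 K → ∀ (Dt : Literature.NumberTheory.EllipticCurves.ModularForms.ModularParametrizationData W (W.conductorNorm ℤ)) (β : ℤ) (ι : K →+* ℂ), (4 * (W.conductorNorm ℤ : ℤ))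 ∣ β ^ 2 - NumberField.discr K → (∀ d₁ : Literature.NumberTheory.EllipticCurves.KolyvaginHeegnerData Dt β ι 1, IsOfFinAddOrder d₁.derivedPoint) → ∀ θ k : ℕ, ∃ (n : ℕ) (d : Literature.NumberTheory.EllipticCurves.KolyvaginHeegnerData Dt β ι n) (M : ℕ), Literature.NumberTheory.EllipticCurves.KolyvaginDescent.KolSupp (Literature.NumberTheory.EllipticCurves.Zhang2014.IsKolyvaginPrime (W.conductorNorm ℤ) W K 2) n ∧ 1 ≤ M ∧ ((θ * M + k : ℕ) : ℕ∞) ≤ Literature.NumberTheory.EllipticCurves.Zhang2014.levelIndex W 2 n ∧ d.kolyvaginClass Nat.prime_two M ≠ 0 :=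
  torsionLevelOneTheta_of_strongNonzeroSystem (KolyvaginSwap.strongNonzeroSystem_of_boundedDefect h)

/-! ## §2 The margin torsion stub (27014) is the `θ = 1` case; hence also from U1 -/

/-- **`stub_torsionLevelOneTheta` ⟹ `stub_torsionLevelOneMargin`** (the registered torsion stubs of the 27219
and 27014 skeletons, signatures VERBATIM): the additive margin `M + k ≤ M(n)` is the relative margin at
`θ = 1`. Both sides OPEN. [cite: Kolyvagin1991MathAnn, p. 257 (relative margins)] -/
theorem torsionLevelOneMargin_of_torsionLevelOneTheta
    (h : ∀ (W : WeierstrassCurve ℚ) [W.IsElliptic] [W.IsGloballyMinimal], ¬ W.HasCM → (Literature.NumberTheory.EllipticCurves.Rank1Residual.GoodOrd W 2 ∨ Literature.NumberTheory.EllipticCurves.Rank1Residual.Mult W 2) → (∀ m : ℕ, W.HasSurjectiveModNGaloisRep (2 ^ m : ℕ)) → ∀ (K : Type) [Field K] [NumberField K], Literature.NumberTheory.EllipticCurves.IsImaginaryQuadratic K → ∀ [NeZero (W.conductorNorm ℤ)], Literature.NumberTheory.EllipticCurves.SatisfiesHeegnerHypothesis (W.conductorNorm ℤ) K → Odd (NumberField.discr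 K) → NumberField.discr K ≠ -3 → AddSubgroup.torsionBy (W.baseChange K).toAffine.Point (2 : ℤ) = ⊥ → Literature.NumberTheory.EllipticCurves.SatisfiesHeegnerHypothesis 2 K → ∀ (Dt : Literature.NumberTheory.EllipticCurves.ModularForms.ModularParametrizationData W (W.conductorNorm ℤ)) (β : ℤ) (ι : K →+* ℂ), (4 * (W.conductorNorm ℤ : ℤ)) ∣ β ^ 2 - NumberField.discr K → (∀ d₁ : Literature.NumberTheory.EllipticCurves.KolyvaginHeegnerData Dt β ι 1, IsOfFinAddOrder d₁.derivedPoint) → ∀ θ k : ℕ, ∃ (n : ℕ) (d : Literature.NumberTheory.EllipticCurves.KolyvaginHeegnerData Dt β ι n) (M : ℕ), Literature.NumberTheory.EllipticCurves.KolyvaginDescent.KolSupp (Literature.NumberTheory.EllipticCurves.Zhang2014.IsKolyvaginPrime (W.conductorNorm ℤ) W K 2) n ∧ 1 ≤ M ∧ ((θ * M + k : ℕ) : ℕ∞) ≤ Literature.NumberTheory.EllipticCurves.Zhang2014.levelIndex W 2 n ∧ d.kolyvaginClass Nat.prime_two M ≠ 0) :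
    ∀ (W : WeierstrassCurve ℚ) [W.IsElliptic] [W.IsGloballyMinimal], ¬ W.HasCM → (Literature.NumberTheory.EllipticCurves.Rank1Residual.GoodOrd W 2 ∨ Literature.NumberTheory.EllipticCurves.Rank1Residual.Mult W 2) → (∀ m : ℕ, W.HasSurjectiveModNGaloisRep (2 ^ m : ℕ)) → ∀ (K : Type) [Field K] [NumberField K], Literature.NumberTheory.EllipticCurves.IsImaginaryQuadratic K → ∀ [NeZero (W.conductorNorm ℤ)], Literature.NumberTheory.EllipticCurves.SatisfiesHeegnerHypothesis (W.conductorNorm ℤ) K → Odd (NumberField.discr K) → NumberField.discr K ≠ -3 → AddSubgroup.torsionBy (W.baseChange K).toAffine.Point (2 : ℤ) = ⊥ → Literature.NumberTheory.EllipticCurves.SatisfiesHeegnerHypothesis 2 K → ∀ (Dt : Literature.NumberTheory.EllipticCurves.ModularForms.ModularParametrizationData W (W.conductorNorm ℤ)) (β : ℤ) (ι : K →+* ℂ), (4 * (W.conductorNorm ℤ : ℤ)) ∣ β ^ 2 - NumberField.discr K → (∀ d₁ : Literature.NumberTheory.EllipticCurves.KolyvaginHeegnerData Dt β ι 1, IsOfFinAddOrder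 d₁.derivedPoint) → ∀ k : ℕ, ∃ (n : ℕ) (d : Literature.NumberTheory.EllipticCurves.KolyvaginHeegnerData Dt β ι n) (M : ℕ), Literature.NumberTheory.EllipticCurves.KolyvaginDescent.KolSupp (Literature.NumberTheory.EllipticCurves.Zhang2014.IsKolyvaginPrime (W.conductorNorm ℤ) W K 2) n ∧ 1 ≤ M ∧ ((M + k : ℕ) : ℕ∞) ≤ Literature.NumberTheory.EllipticCurves.Zhang2014.levelIndex W 2 n ∧ d.kolyvaginClass Nat.prime_two M ≠ 0 := by
  intro W _ _ hCM hred hsur K _ _ hK _ hHN hodd hne3 htors hH2 Dt β ι hβ htor k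
  obtain ⟨n, d, M, hsupp, hM1, hle, hne⟩ :=
    h W hCM hred hsur K hK hHN hodd hne3 htors hH2 Dt β ι hβ htor 1 k
  exact ⟨n, d, M, hsupp, hM1, by simpa only [one_mul] using hle, hne⟩

/-- **U1 ⟹ `stub_torsionLevelOneMargin`**: the registered torsion stub of 27014 follows from U1
`KolyvaginBoundedDefectAtTwo` (stmt-BirchSwinnertonDyer-28083) alone (`θ = 1` of
`torsionLevelOneTheta_of_boundedDefect`). Both sides OPEN; closes nothing.
[cite: Kolyvagin1991MathAnn, §2 (2.1), Conj. 2.5] -/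
theorem torsionLevelOneMargin_of_boundedDefect (h : KolyvaginBoundedDefectAtTwo) :
    ∀ (W : WeierstrassCurve ℚ) [W.IsElliptic] [W.IsGloballyMinimal], ¬ W.HasCM → (Literature.NumberTheory.EllipticCurves.Rank1Residual.GoodOrd W 2 ∨ Literature.NumberTheory.EllipticCurves.Rank1Residual.Mult W 2) → (∀ m : ℕ, W.HasSurjectiveModNGaloisRep (2 ^ m : ℕ)) → ∀ (K : Type) [Field K] [NumberField K], Literature.NumberTheory.EllipticCurves.IsImaginaryQuadratic K → ∀ [NeZero (W.conductorNorm ℤ)], Literature.NumberTheory.EllipticCurves.SatisfiesHeegnerHypothesis (W.conductorNorm ℤ) K → Odd (NumberField.discr K) → NumberField.discr K ≠ -3 → AddSubgroup.torsionBy (W.baseChange K).toAffine.Point (2 : ℤ) = ⊥ → Literature.NumberTheory.EllipticCurves.SatisfiesHeegnerHypothesis 2 K → ∀ (Dt : Literature.NumberTheory.EllipticCurves.ModularForms.ModularParametrizationData W (W.conductorNorm ℤ)) (β : ℤ) (ι : K →+* ℂ), (4 * (W.conductorNorm ℤ : ℤ)) ∣ β ^ 2 - NumberField.discr K → (∀ d₁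 : Literature.NumberTheory.EllipticCurves.KolyvaginHeegnerData Dt β ι 1, IsOfFinAddOrder d₁.derivedPoint) → ∀ k : ℕ, ∃ (n : ℕ) (d : Literature.NumberTheory.EllipticCurves.KolyvaginHeegnerData Dt β ι n) (M : ℕ), Literature.NumberTheory.EllipticCurves.KolyvaginDescent.KolSupp (Literature.NumberTheory.EllipticCurves.Zhang2014.IsKolyvaginPrime (W.conductorNorm ℤ) W K 2) n ∧ 1 ≤ M ∧ ((M + k : ℕ) : ℕ∞) ≤ Literature.NumberTheory.EllipticCurves.Zhang2014.levelIndex W 2 n ∧ d.kolyvaginClass Nat.prime_two M ≠ 0 :=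
  torsionLevelOneMargin_of_torsionLevelOneTheta (torsionLevelOneTheta_of_boundedDefect h)

/-! ## §3 The margin torsion stub in McCallum's point currency -/

/-- **`stub_torsionLevelOneMargin` (27014) is EQUIVALENT to its point form**: on the habitat and for every frame
whose conductor-`1` derived points are all torsion, «for every margin `k` some class `c_M(n) ≠ 0` with `1 ≤ M`,
`M + k ≤ M(n)`» iff «for every `k` some derived Heegner point `P(n)` (at a square-free product `n` of Kolyvagin
primes at `2`) is NOT `2^M`-divisible in `E(K[n])` with `1 ≤ M`, `M + k ≤ M(n)`» — McCallum's Cor. 4.5 at `2`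
with both standing inputs supplied on the habitat (`kolyvaginClass_two_ne_zero_iff_not_pDiv`; `M ≤ M + k ≤ M(n)`).
A re-expression: nothing is asserted about either side. [cite: McCallumLMS1991, Cor. 4.5]
[cite: GrossLMS1991, Prop. 3.6, Lemma 4.3, Prop. 4.7 (1)] [cite: WZhang2014, Thm. 1.1 (κ^∞ ≠ 0)] -/
theorem torsionLevelOneMargin_iff_pointForm :
    (∀ (W : WeierstrassCurve ℚ) [W.IsElliptic] [W.IsGloballyMinimal], ¬ W.HasCM → (Literature.NumberTheory.EllipticCurves.Rank1Residual.GoodOrd W 2 ∨ Literature.NumberTheory.EllipticCurves.Rank1Residual.Mult W 2) → (∀ m : ℕ, W.HasSurjectiveModNGaloisRep (2 ^ m : ℕ)) → ∀ (K : Type) [Field K] [NumberField K], Literature.NumberTheory.EllipticCurves.IsImaginaryQuadratic K → ∀ [NeZero (W.conductorNorm ℤ)], Literature.NumberTheory.EllipticCurves.SatisfiesHeegnerHypothesis (W.conductorNorm ℤ) K → Odd (NumberField.discr K) → NumberField.discr K ≠ -3 → AddSubgroup.torsionBy (W.baseChange K).toAffine.Point (2 : ℤ) = ⊥ → Literature.NumberTheory.EllipticCurves.SatisfiesHeegnerHypothesis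 2 K → ∀ (Dt : Literature.NumberTheory.EllipticCurves.ModularForms.ModularParametrizationData W (W.conductorNorm ℤ)) (β : ℤ) (ι : K →+* ℂ), (4 * (W.conductorNorm ℤ : ℤ)) ∣ β ^ 2 - NumberField.discr K → (∀ d₁ : Literature.NumberTheory.EllipticCurves.KolyvaginHeegnerData Dt β ι 1, IsOfFinAddOrder d₁.derivedPoint) → ∀ k : ℕ, ∃ (n : ℕ) (d : Literature.NumberTheory.EllipticCurves.KolyvaginHeegnerData Dt β ι n) (M : ℕ), Literature.NumberTheory.EllipticCurves.KolyvaginDescent.KolSupp (Literature.NumberTheory.EllipticCurves.Zhang2014.IsKolyvaginPrime (W.conductorNorm ℤ) W K 2) n ∧ 1 ≤ M ∧ ((M + k : ℕ) : ℕ∞) ≤ Literature.NumberTheory.EllipticCurves.Zhang2014.levelIndex W 2 n ∧ d.kolyvaginClass Nat.prime_two M ≠ 0) ↔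
    (∀ (W : WeierstrassCurve ℚ) [W.IsElliptic] [W.IsGloballyMinimal], ¬ W.HasCM → (Literature.NumberTheory.EllipticCurves.Rank1Residual.GoodOrd W 2 ∨ Literature.NumberTheory.EllipticCurves.Rank1Residual.Mult W 2) → (∀ m : ℕ, W.HasSurjectiveModNGaloisRep (2 ^ m : ℕ)) → ∀ (K : Type) [Field K] [NumberField K], Literature.NumberTheory.EllipticCurves.IsImaginaryQuadratic K → ∀ [NeZero (W.conductorNorm ℤ)], Literature.NumberTheory.EllipticCurves.SatisfiesHeegnerHypothesis (W.conductorNorm ℤ) K → Odd (NumberField.discr K) → NumberField.discr K ≠ -3 → AddSubgroup.torsionBy (W.baseChange K).toAffine.Point (2 : ℤ) = ⊥ → Literature.NumberTheory.EllipticCurves.SatisfiesHeegnerHypothesis 2 K → ∀ (Dt : Literature.NumberTheory.EllipticCurves.ModularForms.ModularParametrizationData W (W.conductorNorm ℤ)) (β : ℤ) (ι : K →+* ℂ), (4 * (W.conductorNorm ℤ : ℤ)) ∣ β ^ 2 - NumberField.discr K → (∀ d₁ : Literature.NumberTheory.EllipticCurves.KolyvaginHeegnerData Dt β ι 1, IsOfFinAddOrder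 d₁.derivedPoint) → ∀ k : ℕ, ∃ (n : ℕ) (d : Literature.NumberTheory.EllipticCurves.KolyvaginHeegnerData Dt β ι n) (M : ℕ), Literature.NumberTheory.EllipticCurves.KolyvaginDescent.KolSupp (Literature.NumberTheory.EllipticCurves.Zhang2014.IsKolyvaginPrime (W.conductorNorm ℤ) W K 2) n ∧ 1 ≤ M ∧ ((M + k : ℕ) : ℕ∞) ≤ Literature.NumberTheory.EllipticCurves.Zhang2014.levelIndex W 2 n ∧ ¬ Koly.PDiv d 2 M) := by
  refine forall_congr' fun W ↦ forall_congr' fun _ ↦ forall_congr' fun _ ↦ forall_congr' fun _ ↦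
    forall_congr' fun _ ↦ forall_congr' fun hsur ↦ forall_congr' fun K ↦ forall_congr' fun _ ↦
    forall_congr' fun _ ↦ forall_congr' fun hK ↦ forall_congr' fun _ ↦ forall_congr' fun hH ↦
    forall_congr' fun hodd ↦ forall_congr' fun hne3 ↦ forall_congr' fun _ ↦ forall_congr' fun _ ↦
    forall_congr' fun Dt ↦ forall_congr' fun β ↦ forall_congr' fun ι ↦ forall_congr' fun _ ↦
    forall_congr' fun _ ↦ forall_congr' fun k ↦ ?_
  have hs : W.HasSurjectiveModNGaloisRep ((2 ^ 1 : ℕ) : ℤ) := hsur 1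
  rw [pow_one] at hs
  refine exists_congr fun n ↦ exists_congr fun d ↦ exists_congr fun M ↦ ?_
  have hMk : ((M + k : ℕ) : ℕ∞) ≤ Literature.NumberTheory.EllipticCurves.Zhang2014.levelIndex W 2 n →
      (M : ℕ∞) ≤ Literature.NumberTheory.EllipticCurves.Zhang2014.levelIndex W 2 n :=
    fun hle ↦ le_trans (by exact_mod_cast Nat.le_add_right M k) hle
  refine ⟨fun ⟨hn, h1, hM, hne⟩ ↦ ⟨hn, h1, hM, ?_⟩, fun ⟨hn, h1, hM, hne⟩ ↦ ⟨hn, h1, hM, ?_⟩⟩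
  · exact (KolyvaginRankRigidity.kolyvaginClass_two_ne_zero_iff_not_pDiv W hs hK hodd hne3 hH hn d
      (hMk hM)).mp hne
  · exact (KolyvaginRankRigidity.kolyvaginClass_two_ne_zero_iff_not_pDiv W hs hK hodd hne3 hH hn d
      (hMk hM)).mpr hne

/-- **The supplier's direction for the theta form** (what a derived-point certificate or a ported induction
delivers IS a witness of `stub_torsionLevelOneTheta`'s conclusion): on the habitat (`ρ̄_{E,2}` onto, `K`
imaginary quadratic, `d_K` odd `≠ −3`, Heegner hypothesis for `N_E`), a square-free product `n` of Kolyvagin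
primes at `2`, a datum `d` of conductor `n` and a level `1 ≤ M ≤ M(n)` with `θ M + k ≤ M(n)` and
`2^M ∤ P(n)` in `E(K[n])` give the class `c_M(n) ≠ 0` with the relative margin. (For `θ ≥ 1` the clause
`M ≤ M(n)` is implied by the margin; at `θ = 0` it is needed for the `Γ_K`-invariance of `[P(n)]` mod `2^M`.)
[cite: McCallumLMS1991, Cor. 4.5] [cite: GrossLMS1991, Prop. 3.6, Lemma 4.3] -/
theorem exists_class_of_pointCertificate_theta {K : Type} [Field K] [NumberField K]
    (W : WeierstrassCurve ℚ) [W.IsElliptic] [W.IsGloballyMinimal] [NeZero (W.conductorNorm ℤ)]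
    (hs : W.HasSurjectiveModNGaloisRep 2) (hK : IsImaginaryQuadratic K) (hodd : Odd (NumberField.discr K))
    (hne3 : NumberField.discr K ≠ -3) (hH : SatisfiesHeegnerHypothesis (W.conductorNorm ℤ) K)
    {Dt : ModularParametrizationData W (W.conductorNorm ℤ)} {β : ℤ} {ι : K →+* ℂ} {θ k n M : ℕ}
    (hn : KolyvaginDescent.KolSupp (Zhang2014.IsKolyvaginPrime (W.conductorNorm ℤ) W K 2) n)
    (d : KolyvaginHeegnerData Dt β ι n) (hM1 : 1 ≤ M) (hM : (M : ℕ∞) ≤ Zhang2014.levelIndex W 2 n)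
    (hθ : ((θ * M + k : ℕ) : ℕ∞) ≤ Zhang2014.levelIndex W 2 n) (hcert : ¬ Koly.PDiv d 2 M) :
    ∃ (n : ℕ) (d : KolyvaginHeegnerData Dt β ι n) (M : ℕ),
      KolyvaginDescent.KolSupp (Zhang2014.IsKolyvaginPrime (W.conductorNorm ℤ) W K 2) n ∧ 1 ≤ M ∧
        ((θ * M + k : ℕ) : ℕ∞) ≤ Zhang2014.levelIndex W 2 n ∧ d.kolyvaginClass Nat.prime_two M ≠ 0 :=
  ⟨n, d, M, hn, hM1, hθ,
    (KolyvaginRankRigidity.kolyvaginClass_two_ne_zero_iff_not_pDiv W hs hK hodd hne3 hH hn d hM).mpr hcert⟩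

end Summit.BirchSwinnertonDyer.BirchSwinnertonDyer.Theorems.KolyvaginAtTwo

end
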